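import Summits.AtomisticToContinuum.Crystallization.Theorems.OverbindingBudgetGrossMargin
import Summits.AtomisticToContinuum.Crystallization.Theorems.ChartedPlanarOrderBarlowGluing
import Summits.AtomisticToContinuum.Crystallization.Theorems.ChartedPlanarOrderChannelCertR1P

/-!
# The `OverbindingBudget` cone XL with slot 5 discharged (cone XLII)

Route `OverbindingBudget` (stmt-AtomisticToContinuum-31280), cell `decomp-a2c`, lens 3.  Slot 5 of the cut of
record — `hB₂ : BarlowGluingW` in cone XL `OverbindingBudgetGrossMargin.rdef_fortieth_of_recordK_gross_ref`
(and in cone XXXIX `ChartedPlanarOrderGapStressCone.rdef_thirtyninth_of_recordK_cert_ref`) — is the theorem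
`ChartedPlanarOrderBarlowGluing.barlowGluingW_holds`.  (Numeral per critic row 556 of cell `decomp-a2c`: cone XLI is lens-4 g37's
`OverbindingBudgetMisfitCensus.rdef_of_ceg_meg`, the cut of record since 2026-08-31T20:28Z; cone XL stays the alternate cut, and a proved
`BarlowGluingW` retires one of its leaves permanently.)  This file records the re-cut cones (twenty hypotheses each), nothing else:

* `rdef_fortysecond_of_recordK_gross_ref` — cone XL without `hB₂` (slot 1 in the `GrossLiouvilleLaw` currency);
* `rdef_fortysecond_of_recordK_cert_ref` — cone XXXIX without `hB₂` (slot 1 in the `GrossCleanBallsU` currency);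
* `rdef_fortysecond_of_recordK_gross_R1P` — cone XLII with slot 7c‴P `TubeConvexRefP (17/16) (1/40) s₁ s₂ 1 0` further discharged to
  the two census-certified T-branch Hessian leaves of `…ChartedPlanarOrderChannelCertR1P` [CERT·M, TAG 182 R1′] (side condition `0 < s₁`).
-/

noncomputable section

namespace Summit.AtomisticToContinuum.Crystallization.Theorems.ChartedPlanarOrderBarlowGluingCone

open Summit.AtomisticToContinuum.Crystallization.Theses.OverbindingBudget (RobustDefectLimitWindows)
open Summit.AtomisticToContinuum.Crystallization.Theses.PricedLinkCensus (ChargedEnergyGap)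
open Summit.AtomisticToContinuum.Crystallization.Theorems.ChargedEnergyGapNegative (eStar)
open Summit.AtomisticToContinuum.Crystallization.Theorems.OverbindingBudgetUniformCutStatements (GrossCleanBallsU)
open Summit.AtomisticToContinuum.Crystallization.Theorems.OverbindingBudgetGradedBareness (CleanlessExcessT)
open Summit.AtomisticToContinuum.Crystallization.Theorems.OverbindingBudgetCoherentCut (CoherentResidual)
open Summit.AtomisticToContinuum.Crystallization.Theorems.OverbindingBudgetEdgeRelaxation (rdef_of_grossU_edgeRelaxation_record)
open Summit.AtomisticToContinuum.Crystallization.Theorems.OverbindingBudgetElasticSplitScale (CompressedVirialLaw)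
open Summit.AtomisticToContinuum.Crystallization.Theorems.OverbindingBudgetScaleWidening (DoorPeriodicW)
open Summit.AtomisticToContinuum.Crystallization.Theorems.OverbindingBudgetTwoShellShape (TwoShellShape BarlowGluingW)
open Summit.AtomisticToContinuum.Crystallization.Theorems.OverbindingBudgetStackedRigidityW (StackedReductionW)
open Summit.AtomisticToContinuum.Crystallization.Theorems.OverbindingBudgetRegistryCut (RegistryResidual RegistryTube)
open Summit.AtomisticToContinuum.Crystallization.Theorems.OverbindingBudgetRegistryDichotomy (BalancedLocus)
open Summit.AtomisticToContinuum.Crystallization.Theorems.OverbindingBudgetRegistryDichotomyCW (RegistryMetricCW)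
open Summit.AtomisticToContinuum.Crystallization.Theorems.OverbindingBudgetEnergyTubeBox (RegistryPinningP TubeConvexRefP)
open Summit.AtomisticToContinuum.Crystallization.Theorems.OverbindingBudgetEnergyAffineTable (AffineTableT AffineTableS)
open Summit.AtomisticToContinuum.Crystallization.Theorems.OverbindingBudgetEnergyHeightsOsc (CoarseRegistryT CoarseRegistryS ForceCertT
  ForceCertS)
open Summit.AtomisticToContinuum.Crystallization.Theorems.OverbindingBudgetGrossMargin (GrossLiouvilleLaw rdef_fortieth_of_recordK_gross_ref
  edgeRelaxationLaw_record_of_slots)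
open Summit.AtomisticToContinuum.Crystallization.Theorems.ChartedPlanarOrderBarlowGluing (barlowGluingW_holds)
open Summit.AtomisticToContinuum.Crystallization.Theorems.ChartedPlanarOrderChannelJacobian (PhiT)
open Summit.AtomisticToContinuum.Crystallization.Theorems.ChartedPlanarOrderTubeChannelsBox (HessCertAdjBox HessCertFarBox)
open Summit.AtomisticToContinuum.Crystallization.Theorems.ChartedPlanarOrderTubeChannelsBoxP (boxT)
open Summit.AtomisticToContinuum.Crystallization.Theorems.ChartedPlanarOrderChannelCertR1P (alT₁ alN₁ ga₁ tubeConvexRefP_of_hessCertsT_R1P)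

/-- **Cone XLII: cone XL with slot 5 `BarlowGluingW` DISCHARGED by
`barlowGluingW_holds`.**  Twenty hypotheses: slot 1 `GrossLiouvilleLaw (1/250) 10`, slots 2–4, 6–7d, 8, 9 of
cone XL verbatim. [this file] -/
theorem rdef_fortysecond_of_recordK_gross_ref (s₁ s₂ h₀ h₁ τ' τ'' κ' ω₀ ω B : ℝ) (s₀ : ℕ) (hκ' : 0 < κ') (hω : 0 < ω)
    (hω₀ : 2 * ω₀ ≤ ω) (hs₀ : 4 ≤ s₀) (hs₁ : 0 ≤ s₁) (hs : 289 * s₂ ^ 2 ≤ 388 * s₁ ^ 2)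
    (hPG : GrossLiouvilleLaw (1 / 250) 10) (hCEG : ChargedEnergyGap) (hC : CompressedVirialLaw (1 / 250) 10)
    (hS : TwoShellShape (1 / 100) (3 / 50) (1 / 450)) (hD : DoorPeriodicW 2) (hSR : StackedReductionW 2 (17 / 16))
    (hP : RegistryPinningP (17 / 16) (1 / 40) (3 / 16) s₁ s₂ 1 0) (hT : TubeConvexRefP (17 / 16) (1 / 40) s₁ s₂ 1 0)
    (hCT : CoarseRegistryT (17 / 16) h₀ (3 / 20)) (hFT : ForceCertT h₀ (3 / 20) τ' ω₀)
    (hCS : CoarseRegistryS (17 / 16) h₁ (3 / 20)) (hFS : ForceCertS h₁ (3 / 20) τ'' ω₀)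
    (hTT : AffineTableT (17 / 16) s₁ s₂ ω s₀ B (eStar + 2 * κ')) (hTS : AffineTableS (17 / 16) ω s₀ B (eStar + 2 * κ'))
    (hBal : BalancedLocus s₁ s₂ h₀ (1 / 40)) (hR1 : RegistryResidual s₁ s₂ (1 / 250)) (hR2 : RegistryTube s₁ s₂ (1 / 100) 1)
    (hMet : RegistryMetricCW s₁ s₂ (3 / 500)) (hCE : CleanlessExcessT) (hRes : CoherentResidual 10) : RobustDefectLimitWindows :=
  rdef_fortieth_of_recordK_gross_ref s₁ s₂ h₀ h₁ τ' τ'' κ' ω₀ ω B s₀ hκ' hω hω₀ hs₀ hs₁ hs hPG hCEG hC hS barlowGluingW_holds hD hSR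
    hP hT hCT hFT hCS hFS hTT hTS hBal hR1 hR2 hMet hCE hRes

/-- **Cone XXXIX with slot 5 discharged** (slot 1 in the `GrossCleanBallsU (1/250) 10` currency). [this file] -/
theorem rdef_fortysecond_of_recordK_cert_ref (s₁ s₂ h₀ h₁ τ' τ'' κ' ω₀ ω B : ℝ) (s₀ : ℕ) (hκ' : 0 < κ') (hω : 0 < ω)
    (hω₀ : 2 * ω₀ ≤ ω) (hs₀ : 4 ≤ s₀) (hs₁ : 0 ≤ s₁) (hs : 289 * s₂ ^ 2 ≤ 388 * s₁ ^ 2)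
    (hG : GrossCleanBallsU (1 / 250) 10) (hCEG : ChargedEnergyGap) (hC : CompressedVirialLaw (1 / 250) 10)
    (hS : TwoShellShape (1 / 100) (3 / 50) (1 / 450)) (hD : DoorPeriodicW 2) (hSR : StackedReductionW 2 (17 / 16))
    (hP : RegistryPinningP (17 / 16) (1 / 40) (3 / 16) s₁ s₂ 1 0) (hT : TubeConvexRefP (17 / 16) (1 / 40) s₁ s₂ 1 0)
    (hCT : CoarseRegistryT (17 / 16) h₀ (3 / 20)) (hFT : ForceCertT h₀ (3 / 20) τ' ω₀)
    (hCS : CoarseRegistryS (17 / 16) h₁ (3 / 20)) (hFS : ForceCertS h₁ (3 / 20) τ'' ω₀)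
    (hTT : AffineTableT (17 / 16) s₁ s₂ ω s₀ B (eStar + 2 * κ')) (hTS : AffineTableS (17 / 16) ω s₀ B (eStar + 2 * κ'))
    (hBal : BalancedLocus s₁ s₂ h₀ (1 / 40)) (hR1 : RegistryResidual s₁ s₂ (1 / 250)) (hR2 : RegistryTube s₁ s₂ (1 / 100) 1)
    (hMet : RegistryMetricCW s₁ s₂ (3 / 500)) (hCE : CleanlessExcessT) (hRes : CoherentResidual 10) : RobustDefectLimitWindows :=
  rdef_of_grossU_edgeRelaxation_record hG (edgeRelaxationLaw_record_of_slots s₁ s₂ h₀ h₁ τ' τ'' κ' ω₀ ω B s₀ hκ' hω hω₀ hs₀ hs₁ hs hCEG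
    hC hS barlowGluingW_holds hD hSR hP hT hCT hFT hCS hFS hTT hTS hBal hR1 hR2 hMet) hCE hRes

/-- **Cone XLII with slot 7c‴P down to the two R1′ Hessian leaves** (`tubeConvexRefP_of_hessCertsT_R1P`; `0 < s₁` and
`289·s₂² ≤ 388·s₁²` give `97/150·s₂² < s₁²`).  Twenty-one hypotheses. [this file] -/
theorem rdef_fortysecond_of_recordK_gross_R1P (s₁ s₂ h₀ h₁ τ' τ'' κ' ω₀ ω B : ℝ) (s₀ : ℕ) (hκ' : 0 < κ') (hω : 0 < ω)
    (hω₀ : 2 * ω₀ ≤ ω) (hs₀ : 4 ≤ s₀) (hs₁ : 0 < s₁) (hs : 289 * s₂ ^ 2 ≤ 388 * s₁ ^ 2)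
    (hPG : GrossLiouvilleLaw (1 / 250) 10) (hCEG : ChargedEnergyGap) (hC : CompressedVirialLaw (1 / 250) 10)
    (hS : TwoShellShape (1 / 100) (3 / 50) (1 / 450)) (hD : DoorPeriodicW 2) (hSR : StackedReductionW 2 (17 / 16))
    (hP : RegistryPinningP (17 / 16) (1 / 40) (3 / 16) s₁ s₂ 1 0)
    (hA : HessCertAdjBox (fun a b w' => boxT s₁ s₂ a b w' ∧ PhiT a b) (221 / 100) (1348 / 100) (329 / 100))
    (hF : HessCertFarBox (fun a b w' => boxT s₁ s₂ a b w' ∧ PhiT a b) alT₁ alN₁ ga₁ 6)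
    (hCT : CoarseRegistryT (17 / 16) h₀ (3 / 20)) (hFT : ForceCertT h₀ (3 / 20) τ' ω₀)
    (hCS : CoarseRegistryS (17 / 16) h₁ (3 / 20)) (hFS : ForceCertS h₁ (3 / 20) τ'' ω₀)
    (hTT : AffineTableT (17 / 16) s₁ s₂ ω s₀ B (eStar + 2 * κ')) (hTS : AffineTableS (17 / 16) ω s₀ B (eStar + 2 * κ'))
    (hBal : BalancedLocus s₁ s₂ h₀ (1 / 40)) (hR1 : RegistryResidual s₁ s₂ (1 / 250)) (hR2 : RegistryTube s₁ s₂ (1 / 100) 1)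
    (hMet : RegistryMetricCW s₁ s₂ (3 / 500)) (hCE : CleanlessExcessT) (hRes : CoherentResidual 10) : RobustDefectLimitWindows :=
  rdef_fortysecond_of_recordK_gross_ref s₁ s₂ h₀ h₁ τ' τ'' κ' ω₀ ω B s₀ hκ' hω hω₀ hs₀ hs₁.le hs hPG hCEG hC hS hD hSR hP
    (tubeConvexRefP_of_hessCertsT_R1P (by nlinarith [sq_nonneg s₂, pow_pos hs₁ 2]) hs₁.le hA hF) hCT hFT hCS hFS hTT hTS hBal
    hR1 hR2 hMet hCE hRes

end Summit.AtomisticToContinuum.Crystallization.Theorems.ChartedPlanarOrderBarlowGluingCone
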